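import Summits.KontsevichZagierPeriods.KontsevichZagierPeriods.Theses.FermatIsogeny
import Summits.KontsevichZagierPeriods.KontsevichZagierPeriods.Theorems.FermatIsogenyBetaLinearSectorSectorAssembly
import Summits.KontsevichZagierPeriods.KontsevichZagierPeriods.Theorems.FermatIsogenyBetaLinearSectorQuarters
import Summits.KontsevichZagierPeriods.KontsevichZagierPeriods.Theorems.FermatIsogenyBetaLinearSectorIntegerSums
import Summits.KontsevichZagierPeriods.KontsevichZagierPeriods.Theorems.FermatIsogenyBetaLinearSectorSixthsNormalForms

/-!
# `BetaLinearSector` on the MAXIMAL `(π, Γ(1/4))`-SECTOR, UNCONDITIONALLY: quarter-integral ∪ integral sum ∪ rational class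

Crux `BetaLinearSector` (stmt-KontsevichZagierPeriods-3897, route FermatIsogeny).  THIS file proves the crux UNCONDITIONALLY for every two pairs of
positive rational exponents EACH of which is (i) quarter-integral (`a, b ∈ ¼ℤ`), or (ii) of integral sum (`a + b ∈ ℤ`, any level: the Euler
sector), or (iii) in the rational class (`a ∈ ℤ` or `b ∈ ℤ`, any level: `B(a,b) ∈ ℚ`) — registered anchor `betaLinearSector_quartersMax`.  This is
the largest sector whose Beta values all lie in `ℚ̄·{1, π, Γ(1/4)²/√π, π√π/Γ(1/4)²}`, i.e. the largest sector decidable from Lindemann and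
Chudnovsky's `(π, Γ(1/4))` (both PROVED in the tree); any further pair needs Wolfart–Wüstholz / Huber–Wüstholz (the apex of the line).

Proof = the generic assembly `Assembly.betaLinearSector_of_oracle` fed with: the sector predicate (invariant under the level-lowering steps), the
four canonical cells of the quarter file with their values and separation (`Quarters.value_T0…3`, `vq_sep`), and the normal-form oracle on base
cells — quarter cells (`Quarters.normalForm`), Euler cells `(a, 1 − a)` of any level onto `(c/sin πa)·T₁` (`IntegerSums.nf_reflection` = Euler's
reflection inside the rules for every rational argument, and `T₁ ∼ [π]`), rational cells `(a, 1)`, `(1, b)` of any level onto `(c/a)·T₀`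
(`Thirds.nf_a_one`: one Newton–Leibniz move).

References: M. Kontsevich, D. Zagier, *Periods* (2001), §1.2; G. V. Chudnovsky (1984), Ch. 7 §2 Cor. 2.3.
-/

noncomputable section

namespace Summit.KontsevichZagierPeriods.FermatIsogeny.BetaLinearSector.QuartersMax

open MeasureTheory Set
open Literature.NumberTheory.Transcendental
open Literature.NumberTheory.Transcendental.KZ
open Summit.KontsevichZagierPeriods.FermatIsogeny.BetaLinearSector.HalfIntegers
open Summit.KontsevichZagierPeriods.FermatIsogeny.BetaLinearSector.Assembly (betaLinearSector_of_oracle)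
open Summit.KontsevichZagierPeriods.FermatIsogeny.BetaLinearSector.Quarters (normalForm quarter_cases value_T0 value_T1 value_T2
  value_T3 vq_pos vq_sep)
open Summit.KontsevichZagierPeriods.FermatIsogeny.BetaLinearSector.Thirds (nf_a_one)
open Summit.KontsevichZagierPeriods.FermatIsogeny.BetaLinearSector.IntegerSums (base_cases nf_reflection)
open Summit.KontsevichZagierPeriods.FermatIsogeny.BetaLinearSector.Sixths (T₁_equivalent_piRep)
open Summit.KontsevichZagierPeriods.KontsevichZagierPeriods.BetaCancellationLine (sin_pi_mul_pos)
open Summit.KontsevichZagierPeriods.KontsevichZagierPeriods.BetaCancellationNegative (isAlgebraic_sin_pi_mul_rat)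

set_option quotPrecheck false in
/-- `r` is PINNED as `[(0,1), c · t^{a-1}(1-t)^{b-1}]`. -/
local notation "Pinned⟦" c ", " a ", " b ", " r "⟧" =>
  (IntegralRep.domain r = {x : Fin 1 → ℝ | x 0 ∈ Set.Ioo (0:ℝ) 1} ∧
    Set.EqOn (IntegralRep.integrand r) (fun x : Fin 1 → ℝ => (c : ℝ) * (x 0) ^ (((a : ℚ) : ℝ) - 1) * (1 - x 0) ^ (((b : ℚ) : ℝ) - 1))
      (IntegralRep.domain r))

set_option quotPrecheck false in
/-- The MAXIMAL `(π, Γ(1/4))`-SECTOR predicate on a pair: quarter-integral, or of integral sum, or one exponent integral. -/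
local notation "Sec⟦" a ", " b "⟧" =>
  (((∃ m : ℤ, (a : ℚ) = m / 4) ∧ (∃ m : ℤ, (b : ℚ) = m / 4)) ∨ (∃ m : ℤ, (a : ℚ) + b = m) ∨ (∃ m : ℤ, (a : ℚ) = m) ∨ (∃ m : ℤ, (b : ℚ) = m))

set_option quotPrecheck false in
/-- The BASE-CELL classes of the sector: quarter cell, Euler cell `(a, 1−a)`, or rational cell `(1, b)` / `(a, 1)`. -/
local notation "Cell⟦" a ", " b "⟧" =>
  ((0 : ℚ) < a ∧ (0 : ℚ) < b ∧ (((a = 1 / 4 ∨ a = 1 / 2 ∨ a = 3 / 4 ∨ a = 1) ∧ (b = 1 / 4 ∨ b = 1 / 2 ∨ b = 3 / 4 ∨ b = 1)) ∨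
    (a < 1 ∧ b = 1 - a) ∨ a = 1 ∨ b = 1))

set_option quotPrecheck false in
/-- The four CLASS VALUES at level `4`: `(1, π, Γ(1/4)²/√π, π√π/Γ(1/4)²)`. -/
local notation "vq" => (![1, Real.pi, Real.Gamma (1/4) ^ 2 / Real.sqrt Real.pi, Real.pi * Real.sqrt Real.pi / Real.Gamma (1/4) ^ 2] :
  Fin 4 → ℝ)

/-- The sector predicate survives lowering the second exponent by one. [folklore] -/
theorem sec_sub_right (a b : ℚ) (h : Sec⟦a, b⟧) : Sec⟦a, (b - 1)⟧ := by
  rcases h with ⟨hma, ⟨m, hm⟩⟩ | ⟨m, hm⟩ | ⟨m, hm⟩ | ⟨m, hm⟩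
  · exact Or.inl ⟨hma, ⟨m - 4, by rw [hm]; push_cast; ring⟩⟩
  · exact Or.inr (Or.inl ⟨m - 1, by push_cast; linarith⟩)
  · exact Or.inr (Or.inr (Or.inl ⟨m, hm⟩))
  · exact Or.inr (Or.inr (Or.inr ⟨m - 1, by rw [hm]; push_cast; ring⟩))

/-- The sector predicate survives the swap followed by lowering. [folklore] -/
theorem sec_swap_sub (a b : ℚ) (h : Sec⟦a, b⟧) : Sec⟦b, (a - 1)⟧ := by
  rcases h with ⟨⟨m, hm⟩, hmb⟩ | ⟨m, hm⟩ | ⟨m, hm⟩ | ⟨m, hm⟩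
  · exact Or.inl ⟨hmb, ⟨m - 4, by rw [hm]; push_cast; ring⟩⟩
  · exact Or.inr (Or.inl ⟨m - 1, by push_cast; linarith⟩)
  · exact Or.inr (Or.inr (Or.inr ⟨m - 1, by rw [hm]; push_cast; ring⟩))
  · exact Or.inr (Or.inr (Or.inl ⟨m, hm⟩))

/-- Base pairs of the sector (exponents in `(0,1]`) are base cells: quarter, Euler, or rational (an integer in `(0,1]` is `1`). [folklore] -/
theorem cell_of_sec (a b : ℚ) (ha : 0 < a) (ha1 : a ≤ 1) (hb : 0 < b) (hb1 : b ≤ 1) (h : Sec⟦a, b⟧) : Cell⟦a, b⟧ := by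
  refine ⟨ha, hb, ?_⟩
  rcases h with ⟨hma, hmb⟩ | hm | ⟨m, hm⟩ | ⟨m, hm⟩
  · exact Or.inl ⟨quarter_cases ha ha1 hma, quarter_cases hb hb1 hmb⟩
  · rcases base_cases ha ha1 hb hb1 hm with h | ⟨rfl, rfl⟩
    · exact Or.inr (Or.inl h)
    · exact Or.inr (Or.inr (Or.inl rfl))
  · have h1 : (0 : ℚ) < m := by rw [← hm]; exact ha
    have h2 : (m : ℚ) ≤ 1 := by rw [← hm]; exact ha1
    have h1' : 0 < m := by exact_mod_cast h1
    have h2' : m ≤ 1 := by exact_mod_cast h2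
    have : m = 1 := le_antisymm h2' h1'
    subst this
    exact Or.inr (Or.inr (Or.inl (by rw [hm]; norm_num)))
  · have h1 : (0 : ℚ) < m := by rw [← hm]; exact hb
    have h2 : (m : ℚ) ≤ 1 := by rw [← hm]; exact hb1
    have h1' : 0 < m := by exact_mod_cast h1
    have h2' : m ≤ 1 := by exact_mod_cast h2
    have : m = 1 := le_antisymm h2' h1'
    subst this
    exact Or.inr (Or.inr (Or.inr (by rw [hm]; norm_num)))

/-- **NORMAL-FORM ORACLE of the maximal `(π, Γ(1/4))`-sector**: every base cell normalises onto a non-zero algebraic multiple of one of the four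
canonical cells of the quarter file — quarter cells by `Quarters.normalForm`, Euler cells through `[π]` (`IntegerSums.nf_reflection`,
`T₁ ∼ [π]`), rational cells through the point (`Thirds.nf_a_one`, after a swap for `(1, b)`). [cite: KontsevichZagier2001, §1.2] -/
theorem normalForm_cell (T : Fin 4 → IntegralRep 1)
    (hT0 : Pinned⟦(1 : ℝ), (1 : ℚ), (1 : ℚ), T 0⟧) (hT1 : Pinned⟦(1 : ℝ), (1/2 : ℚ), (1/2 : ℚ), T 1⟧)
    (hT2 : Pinned⟦(Real.sqrt 2), (1/4 : ℚ), (1/2 : ℚ), T 2⟧) (hT3 : Pinned⟦(4 * Real.sqrt 2)⁻¹, (3/4 : ℚ), (1/2 : ℚ), T 3⟧)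
    (c : ℝ) (hc : IsAlgebraic ℚ c) (a b : ℚ) (hcell : Cell⟦a, b⟧) (r : IntegralRep 1) (hr : Pinned⟦c, a, b, r⟧) :
    ∃ (i : Fin 4) (q : ℝ) (hk : IsAlgebraic ℚ (c * q)), q ≠ 0 ∧ Equivalent r ((T i).constMul (c * q) hk) := by
  obtain ⟨ha, hb, hcell⟩ := hcell
  rcases hcell with ⟨hqa, hqb⟩ | ⟨ha1, rfl⟩ | rfl | rfl
  · -- quarter cells
    obtain ⟨i, q, hk, hq, e⟩ := normalForm hc hqa hqb hr T hT0 hT1 hT2 hT3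
    exact ⟨i, q, hk, by rintro rfl; simp at hq, e⟩
  · -- the Euler cell `(a, 1 − a)` onto `(c / sin πa)·T₁`
    have hs : IsAlgebraic ℚ (Real.sin (Real.pi * a)) := isAlgebraic_sin_pi_mul_rat ha
    have hs0 : Real.sin (Real.pi * a) ≠ 0 := (sin_pi_mul_pos ha ha1).ne'
    have hk : IsAlgebraic ℚ (c * (Real.sin (Real.pi * a))⁻¹) := hc.mul hs.inv
    obtain ⟨e, -⟩ := nf_reflection ha ha1 hr hk
    have e₁ : Equivalent ((T 1).constMul (c * (Real.sin (Real.pi * a))⁻¹) hk)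
        (piRep.constMul (c * (Real.sin (Real.pi * a))⁻¹) hk) :=
      (T₁_equivalent_piRep hT1).constMul _ hk
    exact ⟨1, (Real.sin (Real.pi * a))⁻¹, hk, inv_ne_zero hs0, e.trans e₁.symm⟩
  · -- the rational cell `(1, b)`: swap, then the point
    obtain ⟨ρ, hρ⟩ := exists_pinned c hc hb (by norm_num : (0:ℚ) < 1)
    have e : Equivalent r ρ := pinned_swap hc (by norm_num) hb hr hρ
    obtain ⟨q, hk, hq, e', -⟩ := nf_a_one hc hb hρ hT0
    exact ⟨0, q, hk, hq.ne', e.trans e'⟩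
  · -- the rational cell `(a, 1)`: the point
    obtain ⟨q, hk, hq, e, -⟩ := nf_a_one hc ha hr hT0
    exact ⟨0, q, hk, hq.ne', e⟩

/-- **`BetaLinearSector` ON THE MAXIMAL `(π, Γ(1/4))`-SECTOR, UNCONDITIONALLY** (registered anchor `betaLinearSector_quartersMax`): Conjecture 1 of
Kontsevich–Zagier for every pair of Beta integrals `[∫₀¹ t^{a-1}(1-t)^{b-1}dt]`, `[∫₀¹ c·t^{a'-1}(1-t)^{b'-1}dt]` (positive rational exponents, `c` real
algebraic, equal values) such that EACH pair of exponents is quarter-integral, or of integral sum, or has an integral exponent.  Inputs: the generic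
sector assembly, the quarter file (Chudnovsky's `(π, Γ(1/4))`), Euler's reflection inside the rules, the point move. [cite: KontsevichZagier2001, §1.2]
[cite: Chudnovsky1984, Ch. 7 §2 Cor. 2.3] -/
theorem betaLinearSector_quartersMax : ∀ (a b a' b' : ℚ) (c : ℝ), 0 < a → 0 < b → 0 < a' → 0 < b' → IsAlgebraic ℚ c →
    (((∃ m : ℤ, a = m / 4) ∧ (∃ m : ℤ, b = m / 4)) ∨ (∃ m : ℤ, a + b = m) ∨ (∃ m : ℤ, a = m) ∨ (∃ m : ℤ, b = m)) →
    (((∃ m : ℤ, a' = m / 4) ∧ (∃ m : ℤ, b' = m / 4)) ∨ (∃ m : ℤ, a' + b' = m) ∨ (∃ m : ℤ, a' = m) ∨ (∃ m : ℤ, b' = m)) →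
    ∀ (r r' : KZ.IntegralRep 1), r.domain = {x | x 0 ∈ Set.Ioo (0:ℝ) 1} →
    Set.EqOn r.integrand (fun x => (x 0) ^ ((a:ℝ) - 1) * (1 - x 0) ^ ((b:ℝ) - 1)) r.domain →
    r'.domain = {x | x 0 ∈ Set.Ioo (0:ℝ) 1} →
    Set.EqOn r'.integrand (fun x => c * (x 0) ^ ((a':ℝ) - 1) * (1 - x 0) ^ ((b':ℝ) - 1)) r'.domain →
    r.value = r'.value → KZ.Equivalent r r' := by
  intro a b a' b' c ha hb ha' hb' hc hm hm' r r' hd hi hd' hi' hv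
  -- the four canonical cells of the quarter file
  have hs2 : Real.sqrt 2 ^ 2 = 2 := Real.sq_sqrt (by norm_num)
  have h2 : IsAlgebraic ℚ (Real.sqrt 2) := by
    refine ⟨Polynomial.X ^ 2 - Polynomial.C 2, Polynomial.X_pow_sub_C_ne_zero (by norm_num) 2, ?_⟩
    simp [hs2]
  have h4 : IsAlgebraic ℚ (4:ℝ) := by simpa using (isAlgebraic_rat ℚ 4 : IsAlgebraic ℚ (((4:ℚ)) : ℝ))
  have h42 : IsAlgebraic ℚ ((4 * Real.sqrt 2)⁻¹) := (h4.mul h2).inv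
  obtain ⟨T0, hT0⟩ := exists_pinned (1 : ℝ) isAlgebraic_one (by norm_num : (0:ℚ) < 1) (by norm_num : (0:ℚ) < 1)
  obtain ⟨T1, hT1⟩ := exists_pinned (1 : ℝ) isAlgebraic_one (by norm_num : (0:ℚ) < 1/2) (by norm_num : (0:ℚ) < 1/2)
  obtain ⟨T2, hT2⟩ := exists_pinned (Real.sqrt 2) h2 (by norm_num : (0:ℚ) < 1/4) (by norm_num : (0:ℚ) < 1/2)
  obtain ⟨T3, hT3⟩ := exists_pinned (4 * Real.sqrt 2)⁻¹ h42 (by norm_num : (0:ℚ) < 3/4) (by norm_num : (0:ℚ) < 1/2)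
  have hTv : ∀ i : Fin 4, (![T0, T1, T2, T3] i).value = vq i := by
    intro i
    fin_cases i
    · exact value_T0 hT0
    · exact value_T1 hT1
    · exact value_T2 hT2
    · exact value_T3 hT3
  refine betaLinearSector_of_oracle (fun a b => Sec⟦a, b⟧) sec_sub_right sec_swap_sub (fun a b => Cell⟦a, b⟧) cell_of_sec
    (fun a b h => ⟨h.1, h.2.1⟩) ![T0, T1, T2, T3] vq hTv vq_pos vq_sep (normalForm_cell ![T0, T1, T2, T3] hT0 hT1 hT2 hT3)
    a b a' b' ha hb ha' hb' hm hm' 1 c r r' isAlgebraic_one hc ⟨hd, fun x hx => ?_⟩ ⟨hd', hi'⟩ hv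
  simp only [hi hx, one_mul]

end Summit.KontsevichZagierPeriods.FermatIsogeny.BetaLinearSector.QuartersMax

end
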